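import Summits.ResolutionOfSingularities.ResolutionOfSingularities.Theorems.TeissierReduction.Negative.ImpliedBySummit
import Literature.AlgebraicGeometry.Resolution.ResolutionOfCurves
import Literature.AlgebraicGeometry.Resolution.ProjectiveSpaceRegular
import Literature.AlgebraicGeometry.Resolution.ResolutionGlue
import Literature.AlgebraicGeometry.Motives.VarietiesDimensionProofs
import Literature.Topology.KrullDimensionDrop
import HarnessLib

/-!
# Crux `TeissierReduction` (stmt-ResolutionOfSingularities-17085, route `TeissierJung`):
# the low-dimensional layers of the crux, and where its open content starts

The crux asks, for every prime `p`, every algebraically closed `k` of characteristic `p` and every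
integral closed `H ⊆ ℙᵐ_k` with locally principal ideal, for a proper birational `ρ : X' → H`
with `TF X'` (`= TeissierPresented k X'`, bridge `teissierPresented_iff`). By the degenerate
witness of `Negative/ImpliedBySummit.lean` (`teissierPresented_of_isRegular`: a regular integral
`X'` is Teissier-presented over itself, `S := X'`, `π := 𝟙`, `g := 0`), ANY resolution of `H`
is a witness. This file records the resulting unconditional / conditional layers, so that the
crux chain knows exactly where the open content of the item begins:

* `exists_teissierPresented_model_of_hasResolution` — `HasResolution H ⇒` the conclusion of the
  crux for `H` (the positive form of `exists_hypersurface_not_hasResolution_of_not_teissierReduction`);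
* `exists_teissierPresented_model_of_isRegular` — regular `H` (e.g. `H = ℙᵐ` itself, which the
  hypotheses of the crux allow: the zero ideal is principal);
* `exists_teissierPresented_model_of_dim_le_one` — `dim H ≤ 1`, UNCONDITIONALLY (resolution of
  reduced curves by normalisation, tree theorem `hasResolution_of_dim_le_one`);
* `exists_teissierPresented_model_of_dim_le_three` — `dim H ≤ 3`, modulo the in-tree named fact
  `CossartPiltant2019` (`hasResolution_of_dim_le_three`);
* `topologicalKrullDim_le_of_isClosedImmersion_projectiveSpace`,
  `isIso_or_topologicalKrullDim_lt_of_isClosedImmersion_projectiveSpace` — an integral closed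
  subscheme of `ℙᵐ_k` has dimension `≤ m`, and either IS `ℙᵐ` (the immersion is an isomorphism)
  or has dimension `≤ m − 1`;
* `teissierReduction_conclusion_of_le_two` — the crux's conclusion for every `H ⊆ ℙᵐ_k` with
  `m ≤ 2` (points, plane curves, `ℙ²`), unconditionally;
* `teissierReduction_conclusion_of_le_four` — the same for `m ≤ 4` (curves, surfaces, threefold
  hypersurfaces, `ℙ⁴`), modulo `CossartPiltant2019`.

So the OPEN content of the crux is exactly the case `m ≥ 5`, `H ≠ ℙᵐ` (hypersurfaces of
dimension `≥ 4`), where it is implied by — and, granted the companion crux `TeissierResolve`,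
implies — resolution of singularities in characteristic `p` (`Negative/ImpliedBySummit.lean`).
Nothing here uses the local principality of the ideal of `H`.
-/

-- single-problem summit: the doubled namespace component `ResolutionOfSingularities` is forced
set_option linter.dupNamespace false

noncomputable section

open CategoryTheory AlgebraicGeometry TopologicalSpace
open Literature.AlgebraicGeometry.Resolution
open Literature.AlgebraicGeometry.Motives (projectiveSpace)
open Summit.ResolutionOfSingularities.ResolutionOfSingularities.Theorems.TeissierReduction.Negative
  (teissierPresented_of_isRegular)

namespace Summit.ResolutionOfSingularities.ResolutionOfSingularities.Theorems.TeissierReduction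

/-! ## From a resolution to the conclusion of the crux -/

/-- The source of a resolution of an integral scheme is integral (reduced since regular,
irreducible since birational to an irreducible scheme). [folklore] -/
theorem isIntegral_source_of_isResolution {X' X : Scheme.{0}} {π : X' ⟶ X} [IsIntegral X]
    (h : IsResolution π) : IsIntegral X' := by
  haveI : ∀ z : X', _root_.IsReduced (X'.presheaf.stalk z) := fun z => by
    haveI := h.isRegular z
    haveI := isDomain_of_isRegularLocalRing (X'.presheaf.stalk z)
    infer_instance
  haveI : IsReduced X' := isReduced_of_isReduced_stalk X'
  haveI : IrreducibleSpace X' := ComponentGluing.IsBirational.irreducibleSpace h.isBirational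
  exact isIntegral_of_irreducibleSpace_of_isReduced X'

/-- **Any resolution witnesses the crux.** If the integral separated finite-type `k`-scheme `H`
(`k` algebraically closed) has a resolution of singularities `ρ : X' → H`, then `ρ` is a proper
birational morphism from a Teissier-presented scheme: `X'` is regular and integral, hence
Teissier-presented over itself (`teissierPresented_of_isRegular`). [folklore] -/
theorem exists_teissierPresented_model_of_hasResolution {k : Type} [Field k] [IsAlgClosed k]
    (H : Scheme.{0}) (f : H ⟶ Spec (.of k)) [IsSeparated f] [LocallyOfFiniteType f]
    [QuasiCompact f] [IsIntegral H] (h : Scheme.HasResolution H) :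
    ∃ (X' : Scheme.{0}) (ρ : X' ⟶ H), IsProper ρ ∧ IsBirational ρ ∧ TeissierPresented k X' := by
  obtain ⟨X', ρ, hρ⟩ := h
  haveI := hρ.isProper
  haveI : IsIntegral X' := isIntegral_source_of_isResolution hρ
  exact ⟨X', ρ, hρ.isProper, hρ.isBirational, teissierPresented_of_isRegular X' (ρ ≫ f) hρ.isRegular⟩

/-- **Regular `H`** (in particular `H = ℙᵐ_k`): the identity is the required model. [folklore] -/
theorem exists_teissierPresented_model_of_isRegular {k : Type} [Field k] [IsAlgClosed k]
    (H : Scheme.{0}) (f : H ⟶ Spec (.of k)) [IsSeparated f] [LocallyOfFiniteType f]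
    [QuasiCompact f] [IsIntegral H] (hreg : Scheme.IsRegular H) :
    ∃ (X' : Scheme.{0}) (ρ : X' ⟶ H), IsProper ρ ∧ IsBirational ρ ∧ TeissierPresented k X' :=
  exists_teissierPresented_model_of_hasResolution H f hreg.hasResolution

/-- **Dimension `≤ 1`, unconditionally**: an integral separated finite-type `k`-scheme of
dimension `≤ 1` over an algebraically closed field has a proper birational Teissier-presented
model — its normalisation (`hasResolution_of_dim_le_one`, Hartshorne V Rem. 3.8.1, proved in the
tree). [folklore] -/
theorem exists_teissierPresented_model_of_dim_le_one {k : Type} [Field k] [IsAlgClosed k]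
    (H : Scheme.{0}) (f : H ⟶ Spec (.of k)) [IsSeparated f] [LocallyOfFiniteType f]
    [QuasiCompact f] [IsIntegral H] (hdim : topologicalKrullDim H ≤ 1) :
    ∃ (X' : Scheme.{0}) (ρ : X' ⟶ H), IsProper ρ ∧ IsBirational ρ ∧ TeissierPresented k X' :=
  exists_teissierPresented_model_of_hasResolution H f (hasResolution_of_dim_le_one H f hdim)

/-- **Dimension `≤ 3`, modulo Cossart–Piltant**: under the named fact `CossartPiltant2019`, an
integral separated finite-type `k`-scheme of dimension `≤ 3` (`k` algebraically closed of
characteristic `p`) has a proper birational Teissier-presented model. -/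
theorem exists_teissierPresented_model_of_dim_le_three (hCP : CossartPiltant2019.{0}) {p : ℕ}
    {k : Type} [Field k] [CharP k p] [IsAlgClosed k]
    (H : Scheme.{0}) (f : H ⟶ Spec (.of k)) [IsSeparated f] [LocallyOfFiniteType f]
    [QuasiCompact f] [IsIntegral H] (hdim : topologicalKrullDim H ≤ 3) :
    ∃ (X' : Scheme.{0}) (ρ : X' ⟶ H), IsProper ρ ∧ IsBirational ρ ∧ TeissierPresented k X' :=
  exists_teissierPresented_model_of_hasResolution H f
    (hasResolution_of_dim_le_three hCP (p := p) k H f hdim)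

/-! ## Closed subschemes of `ℙᵐ_k`: dimension bookkeeping -/

/-- `x < n + 1 ⇒ x ≤ n` in `WithBot ℕ∞` (the codomain of `topologicalKrullDim`). [folklore] -/
private theorem withBot_le_of_lt_succ {x : WithBot ℕ∞} {n : ℕ}
    (h : x < ((n + 1 : ℕ) : WithBot ℕ∞)) : x ≤ (n : WithBot ℕ∞) := by
  induction x using WithBot.recBotCoe with
  | bot => exact bot_le
  | coe a =>
    induction a using ENat.recTopCoe with
    | top => exact absurd h (by simp)
    | coe b =>
      have hb : b < n + 1 := by exact_mod_cast h
      exact_mod_cast Nat.lt_succ_iff.mp hb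

/-- A closed subscheme of `ℙᵐ_k` has dimension `≤ m`. [folklore] -/
theorem topologicalKrullDim_le_of_isClosedImmersion_projectiveSpace {k : Type} [Field k] (m : ℕ)
    {H : Scheme.{0}} (ι' : H ⟶ (projectiveSpace m k).left) [IsClosedImmersion ι'] :
    topologicalKrullDim H ≤ m := by
  haveI : IsIntegral (projectiveSpace m k).left := isIntegral_projectiveSpace m k
  have hP : topologicalKrullDim ↥(projectiveSpace m k).left ≤ m := by
    haveI := (Literature.AlgebraicGeometry.Motives.isSmoothProjective_projectiveSpace_holds k m
      ).smoothOfRelativeDimension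
    exact (Literature.AlgebraicGeometry.Motives.topologicalKrullDim_eq_of_smoothOfRelativeDimension
      (projectiveSpace m k).hom m).le
  exact ι'.isClosedEmbedding.isInducing.topologicalKrullDim_le.trans hP

/-- **Dichotomy for closed subschemes of `ℙᵐ_k`**: a closed immersion `ι' : H → ℙᵐ_k` is either
an isomorphism (when it is surjective: `ℙᵐ_k` is reduced) or has a proper closed image, in which
case `dim H ≤ m − 1` (a proper closed subset of the irreducible sober space `ℙᵐ_k` of dimension
`m` has smaller dimension). Stated with `m = m' + 1` so that no truncated subtraction occurs.
[folklore] -/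
theorem isIso_or_topologicalKrullDim_le_of_isClosedImmersion_projectiveSpace {k : Type} [Field k]
    (m' : ℕ) {H : Scheme.{0}} (ι' : H ⟶ (projectiveSpace (m' + 1) k).left) [IsClosedImmersion ι'] :
    IsIso ι' ∨ topologicalKrullDim H ≤ m' := by
  haveI : IsIntegral (projectiveSpace (m' + 1) k).left :=
    isIntegral_projectiveSpace (m' + 1) k
  by_cases hsurj : Function.Surjective ι'.base
  · left
    haveI : Surjective ι' := ⟨hsurj⟩
    exact isIso_of_isClosedImmersion_of_surjective ι'
  · right
    have hne : Set.range ι'.base ≠ Set.univ := fun h => hsurj (Set.range_eq_univ.mp h)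
    have hP : topologicalKrullDim ↥(projectiveSpace (m' + 1) k).left < ((m' + 1 + 1 : ℕ) : WithBot ℕ∞) := by
      haveI := (Literature.AlgebraicGeometry.Motives.isSmoothProjective_projectiveSpace_holds k
        (m' + 1)).smoothOfRelativeDimension
      rw [Literature.AlgebraicGeometry.Motives.topologicalKrullDim_eq_of_smoothOfRelativeDimension
        (projectiveSpace (m' + 1) k).hom (m' + 1)]
      exact_mod_cast Nat.lt_succ_self (m' + 1)
    have hlt := Literature.Topology.topologicalKrullDim_lt_of_isClosed_ssubset
      ι'.isClosedEmbedding.isClosed_range hne (m' + 1) hP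
    have hH : topologicalKrullDim H = topologicalKrullDim (Set.range ι'.base) :=
      IsHomeomorph.topologicalKrullDim_eq _
        ι'.isClosedEmbedding.isEmbedding.toHomeomorph.isHomeomorph
    rw [hH]
    exact withBot_le_of_lt_succ hlt

/-! ## The crux's conclusion for `m ≤ 2` (unconditionally) and `m ≤ 4` (modulo Cossart–Piltant) -/

/-- **The conclusion of `TeissierReduction` for `H ⊆ ℙᵐ_k`, `m ≤ 2`, unconditionally**: every
integral closed subscheme of `ℙ^m_k`, `m ≤ 2` (`k` algebraically closed, any characteristic) —
a point, a plane curve, or `ℙ²`/`ℙ¹` itself — has a proper birational Teissier-presented model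
(its normalisation, resp. itself). The local principality hypothesis of the crux is not used.
[folklore] -/
theorem teissierReduction_conclusion_of_le_two {k : Type} [Field k] [IsAlgClosed k] {m : ℕ}
    (hm : m ≤ 2) (H : Scheme.{0}) (ι' : H ⟶ (projectiveSpace m k).left) [IsClosedImmersion ι']
    [IsIntegral H] :
    ∃ (X' : Scheme.{0}) (ρ : X' ⟶ H), IsProper ρ ∧ IsBirational ρ ∧ TeissierPresented k X' := by
  haveI := Literature.AlgebraicGeometry.Motives.isProper_projectiveSpace m k
  cases m with
  | zero =>
    exact exists_teissierPresented_model_of_dim_le_one H (ι' ≫ (projectiveSpace 0 k).hom)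
      ((topologicalKrullDim_le_of_isClosedImmersion_projectiveSpace 0 ι').trans
        (by exact_mod_cast Nat.zero_le 1))
  | succ m' =>
    rcases isIso_or_topologicalKrullDim_le_of_isClosedImmersion_projectiveSpace m' ι' with
      hiso | hdim
    · exact exists_teissierPresented_model_of_isRegular H (ι' ≫ (projectiveSpace (m' + 1) k).hom)
        (Scheme.IsRegular.of_iso (inv ι')
          (isRegular_projectiveSpace (m' + 1) k))
    · exact exists_teissierPresented_model_of_dim_le_one H (ι' ≫ (projectiveSpace (m' + 1) k).hom)
        (hdim.trans (by exact_mod_cast (by omega : m' ≤ 1)))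

/-- **The conclusion of `TeissierReduction` for `H ⊆ ℙᵐ_k`, `m ≤ 4`, modulo `CossartPiltant2019`**:
every integral closed subscheme of `ℙ^m_k`, `m ≤ 4` (`k` algebraically closed of characteristic
`p`) — of dimension `≤ 3`, or `ℙ⁴` itself — has a proper birational Teissier-presented model.
So the open content of the crux is `m ≥ 5` (hypersurfaces of dimension `≥ 4`), exactly where
resolution in characteristic `p` is open. -/
theorem teissierReduction_conclusion_of_le_four (hCP : CossartPiltant2019.{0}) {p : ℕ}
    {k : Type} [Field k] [CharP k p] [IsAlgClosed k] {m : ℕ} (hm : m ≤ 4) (H : Scheme.{0})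
    (ι' : H ⟶ (projectiveSpace m k).left) [IsClosedImmersion ι'] [IsIntegral H] :
    ∃ (X' : Scheme.{0}) (ρ : X' ⟶ H), IsProper ρ ∧ IsBirational ρ ∧ TeissierPresented k X' := by
  haveI := Literature.AlgebraicGeometry.Motives.isProper_projectiveSpace m k
  cases m with
  | zero =>
    exact exists_teissierPresented_model_of_dim_le_one H (ι' ≫ (projectiveSpace 0 k).hom)
      ((topologicalKrullDim_le_of_isClosedImmersion_projectiveSpace 0 ι').trans
        (by exact_mod_cast Nat.zero_le 1))
  | succ m' =>
    rcases isIso_or_topologicalKrullDim_le_of_isClosedImmersion_projectiveSpace m' ι' with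
      hiso | hdim
    · exact exists_teissierPresented_model_of_isRegular H (ι' ≫ (projectiveSpace (m' + 1) k).hom)
        (Scheme.IsRegular.of_iso (inv ι')
          (isRegular_projectiveSpace (m' + 1) k))
    · exact exists_teissierPresented_model_of_dim_le_three hCP (p := p) H
        (ι' ≫ (projectiveSpace (m' + 1) k).hom)
        (hdim.trans (by exact_mod_cast (by omega : m' ≤ 3)))

end Summit.ResolutionOfSingularities.ResolutionOfSingularities.Theorems.TeissierReduction

end
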